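import Mathlib.Analysis.InnerProductSpace.PiL2
import Literature.Geometry.DiscreteGeometry.BondGraph
import Literature.MathematicalPhysics.StatisticalMechanics.LennardJonesClusters
import Literature.MathematicalPhysics.StatisticalMechanics.BarlowStacking
import Summits.AtomisticToContinuum.Crystallization.Theorems.ChargedEnergyGap.Negative.FarCopies
import HarnessLib

/-!
# Crux `PricedLinkCensus.ChargedEnergyGap` (stmt-AtomisticToContinuum-14231): two-tolerance sandwich, counting

Line `two-tolerance-sandwich` (lead c2): the COUNTING half of the line's sorry-free composition,
Theorems-side.  Notation (all inlined in the statements): a configuration `y : Fin N → ℝ³` is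
REGULAR if `1/3`-separated with `nearestDist ≤ 16`; site `i` is DEEP at radius `R` if every site
within `R·nn_i` is charge-free at the coarse tolerance `3/100`; COARSE = charged at `3/100`;
SHALLOW = charge-free at `3/100` but not deep; ISOLATED BAND = deep but charged at `1/100`;
a BARLOW CHART at `i` = a rigid image of an ideal Barlow stacking of spacing `nn_i` (any Hägg word)
two-way `nn_i/5`-matching the configuration on the `3·nn_i`-ball.

* `natCard_le_of_near` — covering count under the hard core (`card_le_of_separated_of_dist_le`);
* `shallow_le` — shallow sites are at most `(96R+1)³` per coarse site;
* `cover_le` — `#charged(1/100) ≤ #coarse + #shallow + #isoband`;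
* `card_not_deep` — non-deep = coarse + shallow;
* `deepCoercivity_of_softLayer_of_coercivity` — the line's DEEP COERCIVITY (credit `c` per isolated band
  site on the excess of the deep sub-configuration, debits per coarse/shallow site) follows from SOFT
  LAYER PROPAGATION AT `3/100` (every site with a clean `8·nn`-window carries a Barlow chart) and
  UNIFORM BARLOW COERCIVITY (credit per `4·nn`-interior charged site of a charted index set, debit per
  boundary site), both hypotheses here (they are the line's open stubs `stub_softLayerThree`,
  `stub_barlowCoercivity`): boundary deep sites are `≤ 385³` per non-deep site by packing.
All `[folklore]` bookkeeping.
-/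

noncomputable section

namespace Summit.AtomisticToContinuum.Crystallization.Theorems.TwoToleranceSandwichCounting

open scoped BigOperators
open Literature.MathematicalPhysics.StatisticalMechanics Literature.Geometry.DiscreteGeometry
open Summit.AtomisticToContinuum.Crystallization.Theorems.ChargedEnergyGapNegative (eStar)

/-! ## Finite counting -/

/-- Three-way cover of a finite subtype count. [folklore] -/
theorem natCard_le_add_three {α : Type*} [Finite α] {p q r s : α → Prop}
    (h : ∀ a, p a → q a ∨ r a ∨ s a) :
    Nat.card {a // p a} ≤ Nat.card {a // q a} + Nat.card {a // r a} + Nat.card {a // s a} := by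
  classical
  haveI := Fintype.ofFinite α
  simp only [Nat.card_eq_fintype_card, Fintype.card_subtype]
  calc (Finset.univ.filter p).card
      ≤ ((Finset.univ.filter q ∪ Finset.univ.filter r) ∪ Finset.univ.filter s).card := by
        apply Finset.card_le_card
        intro a ha
        simp only [Finset.mem_filter, Finset.mem_univ, true_and, Finset.mem_union] at ha ⊢
        rcases h a ha with h1 | h2 | h3
        · exact Or.inl (Or.inl h1)
        · exact Or.inl (Or.inr h2)
        · exact Or.inr h3
    _ ≤ (Finset.univ.filter q ∪ Finset.univ.filter r).card + (Finset.univ.filter s).card :=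
        Finset.card_union_le _ _
    _ ≤ (Finset.univ.filter q).card + (Finset.univ.filter r).card + (Finset.univ.filter s).card := by
        have := Finset.card_union_le (Finset.univ.filter q) (Finset.univ.filter r)
        omega

/-- Additivity of a finite subtype count over a predicate and its negation. [folklore] -/
theorem natCard_subtype_add_not {α : Type*} [Finite α] (p q : α → Prop) :
    Nat.card {a // p a} = Nat.card {a // p a ∧ q a} + Nat.card {a // p a ∧ ¬ q a} := by
  classical
  haveI := Fintype.ofFinite α
  simp only [Nat.card_eq_fintype_card, Fintype.card_subtype]
  rw [← Finset.card_union_of_disjoint]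
  · congr 1
    ext a
    simp only [Finset.mem_filter, Finset.mem_univ, true_and, Finset.mem_union]
    tauto
  · exact Finset.disjoint_left.2 fun a ha hb => by
      simp only [Finset.mem_filter, Finset.mem_univ, true_and] at ha hb
      exact hb.2 ha.2

/-- PACKING FIBRE: in a `1/3`-separated injective configuration at most `(6ρ+1)³` sites lie within
distance `ρ ≥ 0` of a given site (`card_le_of_separated_of_dist_le`). [folklore] -/
theorem card_filter_dist_le {N : ℕ} {y : Fin N → EuclideanSpace ℝ (Fin 3)} (hy : Function.Injective y)
    (hsep : ∀ i j : Fin N, i ≠ j → (1 / 3 : ℝ) ≤ dist (y i) (y j)) {ρ : ℝ} (hρ : 0 ≤ ρ) (j : Fin N) :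
    ((Finset.univ.filter (fun i : Fin N => dist (y i) (y j) ≤ ρ)).card : ℝ) ≤ (6 * ρ + 1) ^ 3 := by
  classical
  set F : Finset (Fin N) := Finset.univ.filter (fun i : Fin N => dist (y i) (y j) ≤ ρ) with hFdef
  have hcard : (F.image y).card = F.card := Finset.card_image_of_injective _ hy
  have hpack := card_le_of_separated_of_dist_le (F.image y) (y j) (r := 1 / 3) (R := ρ)
    (by norm_num) hρ
    (fun c hc => by
      obtain ⟨i, hi, rfl⟩ := Finset.mem_image.1 hc
      rw [hFdef, Finset.mem_filter] at hi
      exact hi.2)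
    (fun c hc d hd hcd => by
      obtain ⟨i, -, rfl⟩ := Finset.mem_image.1 hc
      obtain ⟨k, -, rfl⟩ := Finset.mem_image.1 hd
      exact hsep i k (fun h => hcd (by rw [h])))
  rw [hcard, finrank_euclideanSpace_fin] at hpack
  calc (F.card : ℝ) ≤ (2 * ρ / (1 / 3) + 1) ^ 3 := hpack
    _ = (6 * ρ + 1) ^ 3 := by ring

/-- COVERING COUNT: if every site satisfying `p` has a site satisfying `q` within distance `ρ`, then
`#p ≤ (6ρ+1)³·#q` on `1/3`-separated injective configurations. [folklore] -/
theorem natCard_le_of_near {N : ℕ} {y : Fin N → EuclideanSpace ℝ (Fin 3)} (hy : Function.Injective y)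
    (hsep : ∀ i j : Fin N, i ≠ j → (1 / 3 : ℝ) ≤ dist (y i) (y j)) {ρ : ℝ} (hρ : 0 ≤ ρ)
    {p q : Fin N → Prop} (h : ∀ i, p i → ∃ j, q j ∧ dist (y i) (y j) ≤ ρ) :
    (Nat.card {i : Fin N // p i} : ℝ) ≤ (6 * ρ + 1) ^ 3 * (Nat.card {j : Fin N // q j} : ℝ) := by
  classical
  set P : Finset (Fin N) := Finset.univ.filter p with hPdef
  set Q : Finset (Fin N) := Finset.univ.filter q with hQdef
  have hP : Nat.card {i : Fin N // p i} = P.card := by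
    rw [hPdef, Nat.card_eq_fintype_card, Fintype.card_subtype]
  have hQ : Nat.card {j : Fin N // q j} = Q.card := by
    rw [hQdef, Nat.card_eq_fintype_card, Fintype.card_subtype]
  have hcover : P ⊆ Q.biUnion (fun j => Finset.univ.filter (fun i : Fin N => dist (y i) (y j) ≤ ρ)) := by
    intro i hi
    rw [hPdef, Finset.mem_filter] at hi
    obtain ⟨j, hj, hij⟩ := h i hi.2
    simp only [Finset.mem_biUnion, Finset.mem_filter, Finset.mem_univ, true_and, hQdef]
    exact ⟨j, hj, hij⟩
  have h1 : (P.card : ℝ) ≤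
      ((Q.biUnion (fun j => Finset.univ.filter (fun i : Fin N => dist (y i) (y j) ≤ ρ))).card : ℝ) := by
    exact_mod_cast Finset.card_le_card hcover
  have h2 : ((Q.biUnion (fun j => Finset.univ.filter (fun i : Fin N => dist (y i) (y j) ≤ ρ))).card : ℝ) ≤
      ∑ j ∈ Q, ((Finset.univ.filter (fun i : Fin N => dist (y i) (y j) ≤ ρ)).card : ℝ) := by
    exact_mod_cast Finset.card_biUnion_le
  have h3 : ∑ j ∈ Q, ((Finset.univ.filter (fun i : Fin N => dist (y i) (y j) ≤ ρ)).card : ℝ) ≤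
      ∑ _j ∈ Q, (6 * ρ + 1) ^ 3 := Finset.sum_le_sum fun j _ => card_filter_dist_le hy hsep hρ j
  rw [Finset.sum_const, nsmul_eq_mul] at h3
  rw [hP, hQ]
  linarith

/-- SHALLOW SITES ARE FEW: on regular configurations the shallow sites at window radius `R ≥ 1` number at
most `(96R+1)³` times the coarse sites (a shallow site has a coarse site within `R·nn_i ≤ 16R`). [folklore] -/
theorem shallow_le {R : ℝ} (hR : 1 ≤ R) {N : ℕ} {y : Fin N → EuclideanSpace ℝ (Fin 3)}
    (hy : Function.Injective y) (hsep : ∀ i j : Fin N, i ≠ j → (1 / 3 : ℝ) ≤ dist (y i) (y j))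
    (hnn : ∀ i : Fin N, nearestDist y i ≤ 16) :
    (Nat.card {i : Fin N // IsChargeFree (3 / 100 : ℝ) y i ∧
        ¬ ∀ j : Fin N, dist (y i) (y j) ≤ R * nearestDist y i → IsChargeFree (3 / 100 : ℝ) y j} : ℝ) ≤
      (96 * R + 1) ^ 3 * (Nat.card {j : Fin N // ¬ IsChargeFree (3 / 100 : ℝ) y j} : ℝ) := by
  have hR0 : (0 : ℝ) ≤ 16 * R := by linarith
  have h := natCard_le_of_near hy hsep hR0
    (p := fun i => IsChargeFree (3 / 100 : ℝ) y i ∧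
      ¬ ∀ j : Fin N, dist (y i) (y j) ≤ R * nearestDist y i → IsChargeFree (3 / 100 : ℝ) y j)
    (q := fun j => ¬ IsChargeFree (3 / 100 : ℝ) y j)
    (fun i hi => by
      obtain ⟨-, hnd⟩ := hi
      push Not at hnd
      obtain ⟨j, hj, hjc⟩ := hnd
      refine ⟨j, hjc, hj.trans ?_⟩
      calc R * nearestDist y i ≤ R * 16 := mul_le_mul_of_nonneg_left (hnn i) (by linarith)
        _ = 16 * R := by ring)
  calc _ ≤ (6 * (16 * R) + 1) ^ 3 * (Nat.card {j : Fin N // ¬ IsChargeFree (3 / 100 : ℝ) y j} : ℝ) := h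
    _ = (96 * R + 1) ^ 3 * _ := by ring

/-- THE COVER `charged(1 %) ⊆ coarse ∪ shallow ∪ isolated band`, counted. [folklore] -/
theorem cover_le (R : ℝ) {N : ℕ} (y : Fin N → EuclideanSpace ℝ (Fin 3)) :
    (Nat.card {i : Fin N // ¬ IsChargeFree (1 / 100 : ℝ) y i} : ℝ) ≤
      (Nat.card {i : Fin N // ¬ IsChargeFree (3 / 100 : ℝ) y i} : ℝ) +
        (Nat.card {i : Fin N // IsChargeFree (3 / 100 : ℝ) y i ∧
          ¬ ∀ j : Fin N, dist (y i) (y j) ≤ R * nearestDist y i → IsChargeFree (3 / 100 : ℝ) y j} : ℝ) +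
        (Nat.card {i : Fin N // (∀ j : Fin N, dist (y i) (y j) ≤ R * nearestDist y i →
          IsChargeFree (3 / 100 : ℝ) y j) ∧ ¬ IsChargeFree (1 / 100 : ℝ) y i} : ℝ) := by
  have h := natCard_le_add_three (α := Fin N)
    (p := fun i => ¬ IsChargeFree (1 / 100 : ℝ) y i)
    (q := fun i => ¬ IsChargeFree (3 / 100 : ℝ) y i)
    (r := fun i => IsChargeFree (3 / 100 : ℝ) y i ∧
      ¬ ∀ j : Fin N, dist (y i) (y j) ≤ R * nearestDist y i → IsChargeFree (3 / 100 : ℝ) y j)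
    (s := fun i => (∀ j : Fin N, dist (y i) (y j) ≤ R * nearestDist y i →
      IsChargeFree (3 / 100 : ℝ) y j) ∧ ¬ IsChargeFree (1 / 100 : ℝ) y i)
    (fun i hi => by
      by_cases h3 : IsChargeFree (3 / 100 : ℝ) y i
      · by_cases hd : ∀ j : Fin N, dist (y i) (y j) ≤ R * nearestDist y i → IsChargeFree (3 / 100 : ℝ) y j
        · exact Or.inr (Or.inr ⟨hd, hi⟩)
        · exact Or.inr (Or.inl ⟨h3, hd⟩)
      · exact Or.inl h3)
  exact_mod_cast h

/-! ## Non-deep = coarse + shallow -/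

/-- The non-deep sites are exactly the coarse plus the shallow ones (`R ≥ 0`). [folklore] -/
theorem card_not_deep {R : ℝ} (hR : 0 ≤ R) {N : ℕ} (y : Fin N → EuclideanSpace ℝ (Fin 3)) :
    (Nat.card {i : Fin N // ¬ ∀ j : Fin N, dist (y i) (y j) ≤ R * nearestDist y i →
        IsChargeFree (3 / 100 : ℝ) y j} : ℝ) =
      (Nat.card {i : Fin N // ¬ IsChargeFree (3 / 100 : ℝ) y i} : ℝ) +
        (Nat.card {i : Fin N // IsChargeFree (3 / 100 : ℝ) y i ∧
          ¬ ∀ j : Fin N, dist (y i) (y j) ≤ R * nearestDist y i → IsChargeFree (3 / 100 : ℝ) y j} : ℝ) := by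
  have hself : ∀ i : Fin N, (∀ j : Fin N, dist (y i) (y j) ≤ R * nearestDist y i →
      IsChargeFree (3 / 100 : ℝ) y j) → IsChargeFree (3 / 100 : ℝ) y i := fun i h =>
    h i (by rw [dist_self]; exact mul_nonneg hR (nearestDist_nonneg y i))
  have h1 := natCard_subtype_add_not
    (fun i : Fin N => ¬ ∀ j : Fin N, dist (y i) (y j) ≤ R * nearestDist y i → IsChargeFree (3 / 100 : ℝ) y j)
    (fun i => IsChargeFree (3 / 100 : ℝ) y i)
  have h2 : Nat.card {i : Fin N // (¬ ∀ j : Fin N, dist (y i) (y j) ≤ R * nearestDist y i →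
      IsChargeFree (3 / 100 : ℝ) y j) ∧ IsChargeFree (3 / 100 : ℝ) y i} =
      Nat.card {i : Fin N // IsChargeFree (3 / 100 : ℝ) y i ∧
        ¬ ∀ j : Fin N, dist (y i) (y j) ≤ R * nearestDist y i → IsChargeFree (3 / 100 : ℝ) y j} :=
    Nat.card_congr (Equiv.subtypeEquivRight fun i => by tauto)
  have h3 : Nat.card {i : Fin N // (¬ ∀ j : Fin N, dist (y i) (y j) ≤ R * nearestDist y i →
      IsChargeFree (3 / 100 : ℝ) y j) ∧ ¬ IsChargeFree (3 / 100 : ℝ) y i} =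
      Nat.card {i : Fin N // ¬ IsChargeFree (3 / 100 : ℝ) y i} :=
    Nat.card_congr (Equiv.subtypeEquivRight fun i =>
      ⟨fun h => h.2, fun h => ⟨fun hd => h (hself i hd), h⟩⟩)
  rw [h1, h2, h3]
  push_cast
  ring

/-! ## Deep coercivity from soft layer propagation at `3/100` and uniform Barlow coercivity -/

/-- **DEEP COERCIVITY ⇐ SOFT LAYER PROPAGATION (3 %) + UNIFORM BARLOW COERCIVITY.**  With `R = 8`: every
deep site carries a Barlow chart (`hG`) and a clean `8·nn`-window (definition of deep), so the coercivity
`hH` applies to the deep index set `D`; an isolated band site is either a `4·nn`-interior charged site of `D`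
(credited) or a boundary deep site (a non-`D` site within `4·nn ≤ 64`), and boundary deep sites are
`≤ 385³` per non-deep site (`natCard_le_of_near`), the non-deep sites being the coarse plus the shallow ones
(`card_not_deep`).  Constants: `c`, `C'_F = (c + max C' 0)·385³`, `C = 0`. [folklore] -/
theorem deepCoercivity_of_softLayer_of_coercivity : (∀ (N : ℕ) (y : Fin N → EuclideanSpace ℝ (Fin 3)) (i : Fin N), (∀ j : Fin N, dist (y i) (y j) ≤ 8 * nearestDist y i → IsChargeFree (3 / 100 : ℝ) y j) → ∃ (s : ℤ → ℤ) (g : EuclideanSpace ℝ (Fin 3) ≃ᵃⁱ[ℝ] EuclideanSpace ℝ (Fin 3)), IsHaggSeq s ∧ (∀ j : Fin N, dist (y i) (y j) ≤ 3 * nearestDist y i → ∃ z ∈ barlowStacking (nearestDist y i) (nearestDist y i * Real.sqrt (2 / 3)) s, dist (y j) (g z) ≤ nearestDist y i / 5) ∧ ∀ z ∈ barlowStacking (nearestDist y i) (nearestDist y i * Real.sqrt (2 / 3)) s, dist (y i) (g z) ≤ 3 * nearestDist y i → ∃ j : Fin N, dist (y j) (g z) ≤ nearestDist y i / 5) → (∃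 c : ℝ, 0 < c ∧ ∃ C' : ℝ, ∀ (N : ℕ) (y : Fin N → EuclideanSpace ℝ (Fin 3)), (∀ i j : Fin N, i ≠ j → (1 / 3 : ℝ) ≤ dist (y i) (y j)) → (∀ i : Fin N, nearestDist y i ≤ 16) → ∀ W : Finset (Fin N), (∀ i ∈ W, (∃ (s : ℤ → ℤ) (g : EuclideanSpace ℝ (Fin 3) ≃ᵃⁱ[ℝ] EuclideanSpace ℝ (Fin 3)), IsHaggSeq s ∧ (∀ j : Fin N, dist (y i) (y j) ≤ 3 * nearestDist y i → ∃ z ∈ barlowStacking (nearestDist y i) (nearestDist y i * Real.sqrt (2 / 3)) s, dist (y j) (g z) ≤ nearestDist y i / 5) ∧ ∀ z ∈ barlowStacking (nearestDist y i) (nearestDist y i * Real.sqrt (2 / 3)) s, dist (y i) (g z) ≤ 3 * nearestDist y i → ∃ j : Fin N, dist (y j) (g z) ≤ nearestDist y i / 5) ∧ ∀ j : Fin N, dist (y i) (y j) ≤ 8 * nearestDist y i → IsChargeFree (3 / 100 : ℝ) y j) → c * (Nat.card {i : Fin N // i ∈ W ∧ (∀ j : Fin N, dist (y i) (y j) ≤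 4 * nearestDist y i → j ∈ W) ∧ ¬ IsChargeFree (1 / 100 : ℝ) y i} : ℝ) - C' * (Nat.card {i : Fin N // i ∈ W ∧ ∃ j : Fin N, j ∉ W ∧ dist (y i) (y j) ≤ 4 * nearestDist y i} : ℝ) ≤ (1 / 2 : ℝ) * (∑ i ∈ W, ∑ j ∈ W.erase i, lennardJones (dist (y i) (y j))) - (W.card : ℝ) * eStar) → ∃ R c C' C : ℝ, 1 ≤ R ∧ 0 < c ∧ 0 ≤ C' ∧ ∀ (N : ℕ) (y : Fin N → EuclideanSpace ℝ (Fin 3)), Function.Injective y → ((∀ i j : Fin N, i ≠ j → (1 / 3 : ℝ) ≤ dist (y i) (y j)) ∧ ∀ i : Fin N, nearestDist y i ≤ 16) → ∀ D : Finset (Fin N), (∀ i : Fin N, i ∈ D ↔ ∀ j : Fin N, dist (y i) (y j) ≤ R * nearestDist y i → IsChargeFree (3 / 100 : ℝ) y j) → c * (Nat.card {i : Fin N // (∀ j : Fin N, dist (y i) (y j) ≤ R * nearestDist y i → IsChargeFree (3 / 100 : ℝ) y j) ∧ ¬ IsChargeFree (1 / 100 : ℝ) y i} : ℝ) - C' *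 ((Nat.card {i : Fin N // ¬ IsChargeFree (3 / 100 : ℝ) y i} : ℝ) + (Nat.card {i : Fin N // IsChargeFree (3 / 100 : ℝ) y i ∧ ¬ ∀ j : Fin N, dist (y i) (y j) ≤ R * nearestDist y i → IsChargeFree (3 / 100 : ℝ) y j} : ℝ)) - C * (N : ℝ) ^ (2 / 3 : ℝ) ≤ (1 / 2 : ℝ) * (∑ i ∈ D, ∑ j ∈ D.erase i, lennardJones (dist (y i) (y j))) - (D.card : ℝ) * eStar := by
  classical
  intro hG hH
  obtain ⟨c, hc, C', hH⟩ := hH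
  refine ⟨8, c, (c + max C' 0) * (385 : ℝ) ^ 3, 0, by norm_num, hc, by positivity, ?_⟩
  intro N y hy hreg D hD
  have hW : ∀ i ∈ D, (∃ (s : ℤ → ℤ) (g : EuclideanSpace ℝ (Fin 3) ≃ᵃⁱ[ℝ] EuclideanSpace ℝ (Fin 3)),
      IsHaggSeq s ∧
        (∀ j : Fin N, dist (y i) (y j) ≤ 3 * nearestDist y i →
          ∃ z ∈ barlowStacking (nearestDist y i) (nearestDist y i * Real.sqrt (2 / 3)) s,
            dist (y j) (g z) ≤ nearestDist y i / 5) ∧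
        ∀ z ∈ barlowStacking (nearestDist y i) (nearestDist y i * Real.sqrt (2 / 3)) s,
          dist (y i) (g z) ≤ 3 * nearestDist y i → ∃ j : Fin N, dist (y j) (g z) ≤ nearestDist y i / 5) ∧
      ∀ j : Fin N, dist (y i) (y j) ≤ 8 * nearestDist y i → IsChargeFree (3 / 100 : ℝ) y j :=
    fun i hi => ⟨hG N y i ((hD i).1 hi), (hD i).1 hi⟩
  have h1 := hH N y hreg.1 hreg.2 D hW
  -- cover: isolated band ⊆ interior-charged ∪ boundary
  have hcov : (Nat.card {i : Fin N // (∀ j : Fin N, dist (y i) (y j) ≤ 8 * nearestDist y i →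
      IsChargeFree (3 / 100 : ℝ) y j) ∧ ¬ IsChargeFree (1 / 100 : ℝ) y i} : ℝ) ≤
      (Nat.card {i : Fin N // i ∈ D ∧ (∀ j : Fin N, dist (y i) (y j) ≤ 4 * nearestDist y i → j ∈ D) ∧
          ¬ IsChargeFree (1 / 100 : ℝ) y i} : ℝ) +
        (Nat.card {i : Fin N // i ∈ D ∧ ∃ j : Fin N, j ∉ D ∧ dist (y i) (y j) ≤ 4 * nearestDist y i} : ℝ) := by
    have h := natCard_le_add_three (α := Fin N)
      (p := fun i => (∀ j : Fin N, dist (y i) (y j) ≤ 8 * nearestDist y i →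
        IsChargeFree (3 / 100 : ℝ) y j) ∧ ¬ IsChargeFree (1 / 100 : ℝ) y i)
      (q := fun i => i ∈ D ∧ (∀ j : Fin N, dist (y i) (y j) ≤ 4 * nearestDist y i → j ∈ D) ∧
          ¬ IsChargeFree (1 / 100 : ℝ) y i)
      (r := fun i => i ∈ D ∧ ∃ j : Fin N, j ∉ D ∧ dist (y i) (y j) ≤ 4 * nearestDist y i)
      (s := fun _ => False)
      (fun i hi => by
        have hiD : i ∈ D := (hD i).2 hi.1
        by_cases hint : ∀ j : Fin N, dist (y i) (y j) ≤ 4 * nearestDist y i → j ∈ D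
        · exact Or.inl ⟨hiD, hint, hi.2⟩
        · push Not at hint
          obtain ⟨j, hj, hjD⟩ := hint
          exact Or.inr (Or.inl ⟨hiD, j, hjD, hj⟩))
    have h0 : Nat.card {i : Fin N // False} = 0 := by simp
    rw [h0, add_zero] at h
    exact_mod_cast h
  -- boundary deep sites are few
  have hbd : (Nat.card {i : Fin N // i ∈ D ∧ ∃ j : Fin N, j ∉ D ∧ dist (y i) (y j) ≤ 4 * nearestDist y i} : ℝ)
      ≤ (6 * 64 + 1) ^ 3 * (Nat.card {i : Fin N // ¬ ∀ j : Fin N, dist (y i) (y j) ≤ 8 * nearestDist y i →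
          IsChargeFree (3 / 100 : ℝ) y j} : ℝ) :=
    natCard_le_of_near hy hreg.1 (by norm_num)
      (fun i hi => by
        obtain ⟨-, j, hjD, hj⟩ := hi
        refine ⟨j, fun h => hjD ((hD j).2 h), hj.trans ?_⟩
        have := hreg.2 i
        linarith)
  rw [card_not_deep (by norm_num : (0 : ℝ) ≤ 8) y] at hbd
  set G := (Nat.card {i : Fin N // ¬ IsChargeFree (3 / 100 : ℝ) y i} : ℝ)
  set S := (Nat.card {i : Fin N // IsChargeFree (3 / 100 : ℝ) y i ∧
    ¬ ∀ j : Fin N, dist (y i) (y j) ≤ 8 * nearestDist y i → IsChargeFree (3 / 100 : ℝ) y j} : ℝ)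
  set Bd := (Nat.card {i : Fin N // i ∈ D ∧ ∃ j : Fin N, j ∉ D ∧
    dist (y i) (y j) ≤ 4 * nearestDist y i} : ℝ)
  have hGS : 0 ≤ G + S := by positivity
  have hB0 : 0 ≤ Bd := Nat.cast_nonneg _
  have hC'le : C' ≤ max C' 0 := le_max_left _ _
  have hm0 : 0 ≤ max C' 0 := le_max_right _ _
  have h385 : ((6 : ℝ) * 64 + 1) ^ 3 = (385 : ℝ) ^ 3 := by norm_num
  rw [h385] at hbd
  have hrpow : (0 : ℝ) * (N : ℝ) ^ (2 / 3 : ℝ) = 0 := zero_mul _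
  rw [hrpow, sub_zero]
  refine le_trans ?_ h1
  nlinarith [mul_le_mul_of_nonneg_left hcov hc.le, mul_le_mul_of_nonneg_left hbd (add_nonneg hc.le hm0),
    mul_le_mul_of_nonneg_right hC'le hB0]

end Summit.AtomisticToContinuum.Crystallization.Theorems.TwoToleranceSandwichCounting

end
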